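import Summits.QuantumFields.BalabanUV.Beta.D1BFx.LamDiffDictionary
import Summits.QuantumFields.BalabanUV.Beta.D1BFx.LamPartnerZero

/-!
# `BalabanUV.Beta.D1BFx.LamDiffPartnerLetters` — road «BF-x» for binder row D1, slot (K), (S-N) dictionary, (L3) «ΔΛ-ROWS» FILE 3 «ΔΛ-LETTERS»:
# THE PARTNER LETTERS OF THE Λ-DIFFERENCE REST MEMBER — block covariance (C), exponential localisation (D) and the ZERO-MOMENTUM letters (Z)
# `Σ'_{u′} Nd• m 0 u′ = 0` of `LamDiffDictionary.Ndν`∕`Ndμ`, from the road's OWN covariance letter (W1) for `ε • S` against the leg `Ga`, the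
# generator localisation `hX`, and ONE Δ-letter (W2′)^Δ for the companion `Td` against the table `ffOf (Hd m 0)` — the `T ⊗ T` word needs NO letter

HONEST DEPENDENCY (page 1, mandatory): continuum YM on T⁴ ⇐ BetaPertH ∧ nine spine estimates (0/9 proved); BetaPertH ⇐ (D1) ∧ (D4) ∧
CAP+tail; G-an2-4 gates asym, D1 and NE2/3/4.  HONEST FRAMING (cell contract, verbatim): «discharging `BetaPertH` makes Bałaban's UV
stability UNCONDITIONAL — a real constructive-QFT result; it is NOT the continuum limit and NOT the Clay problem.»  THIS MODULE DISCHARGES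
NOTHING of the wall: [folklore] `tsum`∕Fubini bookkeeping BY NAME — the twins, for a generic table family `Hd` under (LH)∕(CH) and a generic road stencil
`S`, of `LamPartnerLetters` ((C)(D)) and `LamPartnerZero` ((Z): the owner's zero-total law `KernelWardInsertionZero.tsum_resp_eq_zero` at blocking `N := 1`,
the monopole null `LamCoeffAffineNull.tsum_affine_mul_lamCoeffOf`); reused BY NAME: `abs_bubble_le_exp`, `decay_of_two`, `exists_tadpole_T_decay`,
`summable_of_decay_base`, `summable_tadpole_T`, `SLam_translate`.  The covariance letters (W1) (for `ε • S` — at `S := SbfBal` the END's own `hW1`) and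
(W2′)^Δ (for `(−(ε·c₂∕c₁)) • Td m 0` against `ffOf (Hd m 0)`; LINEAR in (companion, table): (W2′)_lit − (W2′)_road once the constants are absorbed) and `hX`
are DISPLAYED HYPOTHESES, not proved here.  No definition, no `def … : Prop`, nothing cited, 0 sorry.  0 wall binders; (K) NOT closed; NOT D1, NOT `BetaPertH`.

ABSOLUTE RULE (cell charter, verbatim): «No internally-minted statement may enter as a cited fact. Every hypothesis is either kernel-proved in
this package or a verbatim quotation of a PUBLISHED theorem with page reference. The manuscript(s) under audit are NOT citable for their own
disputed steps — they are the thing under adjudication; programme-internal (2001/route/tribunal) claims are never citable.»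

CONTENT ([folklore]; `G := Ga n a`, `Y := ffOf (Hd m ·)`, `T := c₁ • SdL n Hd`; sockets `hS`∕`hScov`, (LH) `hH`, (CH) `hHcov`, `hTloc`∕`hTcov`).  §1 (C)
`SdL_translate`, **`Ndν_cov`**, **`Ndμ_cov`**.  §2 (D) `exists_bubble_H_decay`, **`Ndν_decay`**, **`Ndμ_decay`**.  §3 (Z) `summable_bubble_H(')`,
**`ward_total_gen`** (`c·Σ'_u tadpole G (Td m 0 α u) = ε·Σ'_u bubble G (S α u) (Y m 0)` from (W1)+(W2′)^Δ), **`tsum_bubble_SdL_eq_zero`** (the `T ⊗ T`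
cross term `Σ'_u bubble G (SdL n Hd κ u) (Y m 0) = 0` by the monopole null — NO letter), **`tsum_Ndν_eq_zero`**, **`tsum_Ndμ_eq_zero`** (the `hZero•`
hypotheses of `LamRowGlue.gLam_row_eq_zero_of_dict` for FILE 2's dictionary).
Unit `b2b-balaban-gan24-formalise-leaf-05` (gen 49), G-an2-4 swarm leaf prover on road «BF-x» (L3); no existing file touched.
-/

noncomputable section

namespace Summit.QuantumFields.BalabanUV.Beta.D1BFx.LamDiffPartnerLetters

open Finset
open scoped BigOperators
open Literature.MathematicalPhysics.QuantumFieldTheory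
open Literature.MathematicalPhysics.QuantumFieldTheory.Balaban1983to89
open Literature.MathematicalPhysics.QuantumFieldTheory.Balaban1983to89.Beta
open B12Sec2to5 (l1 l1_nonneg)
open ExpKernelCalculus (Site MKer Decays BiLoc VertexFamily bubble tadpole comp shiftK Zl Zl_nonneg bubble_shiftK tadpole_shiftK l1_sub_symm)
open OneStepResolventKernel (Fib KInv decays_KInv shiftK_KInv)
open InterLevelTransport (SLam SLam_translate)
open BalabanStepJets (lamCoeffOf lamCoeffOf_translate)
open KernelWard (divV biLoc_add biLoc_recentre)
open StepJetData (biLoc_smul)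
open KernelReflection (bubble_smul_left bubble_smul_right tadpole_smul)
open Summit.QuantumFields.BalabanUV.Beta.TameKernelCalculus (Spr Loc biLoc_of_le decays_of_le bubble_add_right)
open Summit.QuantumFields.BalabanUV.Beta.D1BFx.FineStencilBF (ffOf ffOf_shiftK)
open Summit.QuantumFields.BalabanUV.Beta.D1BFx.GluonLeg (Ga shiftK_Ga_neg)
open Summit.QuantumFields.BalabanUV.Beta.D1BFx.ReducedKernel (StencilR)
open Summit.QuantumFields.BalabanUV.Beta.D1BFx.DressedBubbleTable (bubble_comm)
open Summit.QuantumFields.BalabanUV.Beta.D1BFx.LamSectorUnfold (exists_abs_lamCoeff_KInv_le)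
open Summit.QuantumFields.BalabanUV.Beta.D1BFx.LamSectorUnfoldGen (bubble_SLam_left)
open Summit.QuantumFields.BalabanUV.Beta.D1BFx.LamCoeffAffineNull (tsum_affine_mul_lamCoeffOf)
open Summit.QuantumFields.BalabanUV.Beta.D1BFx.LamDictionary (summable_exp_zsmul)
open Summit.QuantumFields.BalabanUV.Beta.D1BFx.LamPartnerLetters (abs_bubble_le_exp decay_of_two exists_tadpole_T_decay)
open Summit.QuantumFields.BalabanUV.Beta.D1BFx.LamPartnerZero (summable_of_decay_base summable_tadpole_T)
open Summit.QuantumFields.BalabanUV.Beta.D1BFx.KernelWardInsertionZero (tsum_resp_eq_zero)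
open Summit.QuantumFields.BalabanUV.Beta.D1BFx.LamDiffDictionary (SdL SdL_apply Ndν Ndμ lam_table_common_rate exists_biLoc_SdL)

variable (n : ℕ) [NeZero n] (a : ℝ) {S : StencilR} {Cs δs : ℝ} {Hd : Fin 4 → Site 4 → MKer 4 (Fib 3)} {CH δH : ℝ}
  {Td : Fin 4 → Site 4 → Fin 4 → Site 4 → MKer 4 (Fin 4)} {CT δT : ℝ} (c₁ c₂ : ℝ)

/-! ## §1 (C) Block covariance of the partner functionals -/

section Cov

/-- [folklore] **BLOCK COVARIANCE OF THE GENERIC Λ-PACK**: under (CH) `Hd m (y + t) = shiftK (−(n•t)) (Hd m y)`,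
`SdL n Hd κ (u + n•t) = shiftK (−(n•t)) (SdL n Hd κ u)` (`SLam_translate` with `lamCoeffOf_translate` at `shiftK_KInv`). -/
theorem SdL_translate (hHcov : ∀ (m : Fin 4) (y t : Site 4), Hd m (y + t) = shiftK (-((n : ℤ) • t)) (Hd m y)) (κ : Fin 4) (u t : Site 4) :
    SdL n Hd κ (u + (n : ℤ) • t) = shiftK (-((n : ℤ) • t)) (SdL n Hd κ u) := by
  rw [SdL_apply, SdL_apply, SLam_translate (fun m y κ' u t => lamCoeffOf_translate (fun t => shiftK_KInv (N := n) (d := 3) t) m y κ' u t) hHcov,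
    ffOf_shiftK]

variable {a c₁ c₂}

/-- [folklore] **(C) FOR `Ndν`**: `Ndν m (y + t) (u′ + n•t) = Ndν m y u′` (block covariance of `S`, (CH), the companion's covariance socket `hTcov`). -/
theorem Ndν_cov (hScov : ∀ (κ : Fin 4) (u t : Site 4), S κ (u + (n : ℤ) • t) = shiftK (-((n : ℤ) • t)) (S κ u))
    (hHcov : ∀ (m : Fin 4) (y t : Site 4), Hd m (y + t) = shiftK (-((n : ℤ) • t)) (Hd m y))
    (hTcov : ∀ m y κ u t, Td m (y + t) κ (u + (n : ℤ) • t) = shiftK (-((n : ℤ) • t)) (Td m y κ u)) (μ : Fin 4)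
    (m : Fin 4) (y t u' : Site 4) :
    Ndν n a S Hd Td c₁ c₂ μ m (y + t) (u' + (n : ℤ) • t) = Ndν n a S Hd Td c₁ c₂ μ m y u' := by
  have hn : 1 ≤ n := NeZero.one_le
  simp only [Ndν]
  rw [hScov μ u' t, hHcov m y t, ffOf_shiftK, hTcov m y μ u' t]
  conv_lhs => rw [← shiftK_Ga_neg n a hn t]
  rw [bubble_shiftK, tadpole_shiftK]

/-- [folklore] **(C) FOR `Ndμ`**: `Ndμ m (y + t) (u′ + n•t) = Ndμ m y u′`. -/
theorem Ndμ_cov (hScov : ∀ (κ : Fin 4) (u t : Site 4), S κ (u + (n : ℤ) • t) = shiftK (-((n : ℤ) • t)) (S κ u))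
    (hHcov : ∀ (m : Fin 4) (y t : Site 4), Hd m (y + t) = shiftK (-((n : ℤ) • t)) (Hd m y))
    (hTcov : ∀ m y κ u t, Td m (y + t) κ (u + (n : ℤ) • t) = shiftK (-((n : ℤ) • t)) (Td m y κ u)) (ν : Fin 4)
    (m : Fin 4) (y t u' : Site 4) :
    Ndμ n a S Hd Td c₁ c₂ ν m (y + t) (u' + (n : ℤ) • t) = Ndμ n a S Hd Td c₁ c₂ ν m y u' := by
  have hn : 1 ≤ n := NeZero.one_le
  simp only [Ndμ]
  rw [hScov ν u' t, SdL_translate n hHcov ν u' t, hHcov m y t, ffOf_shiftK, hTcov m y ν u' t]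
  have e : shiftK (-((n : ℤ) • t)) (S ν u') + c₁ • shiftK (-((n : ℤ) • t)) (SdL n Hd ν u') = shiftK (-((n : ℤ) • t)) (S ν u' + c₁ • SdL n Hd ν u') := rfl
  rw [e]
  conv_lhs => rw [← shiftK_Ga_neg n a hn t]
  rw [bubble_shiftK, tadpole_shiftK]

end Cov

/-! ## §2 (D) Exponential localisation of the partner functionals -/
section Decay

variable {a c₁ c₂}

/-- [folklore] The table bubble against a bond-localised stencil family decays exponentially in `|n•y − u|₁` (both slot orders, one constant, one rate) —
`LamPartnerLetters.exists_bubble_Y_decay` with `hessFF n ↦ Hd` under (LH). -/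
theorem exists_bubble_H_decay (hGa : Spr (Ga n a)) (hδs : 0 < δs) (hS : ∀ κ u, BiLoc (S κ u) u u Cs δs) (hδH : 0 < δH)
    (hH : ∀ (m : Fin 4) (y : Site 4), BiLoc (ffOf (Hd m y)) ((n : ℤ) • y) ((n : ℤ) • y) CH δH) (κ : Fin 4) :
    ∃ KB δB : ℝ, 0 ≤ KB ∧ 0 < δB ∧ (∀ (m : Fin 4) (y u : Site 4), |bubble (Ga n a) (S κ u) (ffOf (Hd m y))| ≤ KB * Real.exp (-δB * l1 ((n : ℤ) • y - u)))
      ∧ ∀ (m : Fin 4) (y u : Site 4), |bubble (Ga n a) (ffOf (Hd m y)) (S κ u)| ≤ KB * Real.exp (-δB * l1 ((n : ℤ) • y - u)) := by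
  obtain ⟨CA, δA, hδA, hAd⟩ := hGa
  set δ₀ : ℝ := min δA (min δs δH) with hδ₀def
  have hδ₀ : 0 < δ₀ := lt_min hδA (lt_min hδs hδH)
  have hA : Decays (Ga n a) (|CA|) δ₀ := decays_of_le hAd (min_le_left _ _)
  have hV : ∀ u, BiLoc (S κ u) u u (|Cs|) δ₀ := fun u => biLoc_of_le (hS κ u) ((min_le_right _ _).trans (min_le_left _ _))
  have hY : ∀ (m : Fin 4) (y : Site 4), BiLoc (ffOf (Hd m y)) ((n : ℤ) • y) ((n : ℤ) • y) (|CH|) δ₀ :=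
    fun m y => biLoc_of_le (hH m y) ((min_le_right _ _).trans (min_le_right _ _))
  have hZ1 : 0 ≤ Zl 4 (δ₀ - δ₀ / 2) := Zl_nonneg (by linarith)
  have hZ2 : 0 ≤ Zl 4 (δ₀ / 2 / 2) := Zl_nonneg (by positivity)
  refine ⟨(Fintype.card (Fin 4) : ℝ) * ((Fintype.card (Fin 4) : ℝ) * (((Fintype.card (Fin 4) : ℝ) * (|CA| * |Cs|) * Zl 4 (δ₀ - δ₀ / 2)) *
      ((Fintype.card (Fin 4) : ℝ) * (|CA| * |CH|) * Zl 4 (δ₀ - δ₀ / 2))) * Zl 4 (δ₀ / 2 / 2)) * Zl 4 (δ₀ / 2 / 2), δ₀ / 2 / 2,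
    by positivity, by positivity, fun m y u => (abs_bubble_le_exp hA (hV u) (hY m y) hδ₀).trans (le_of_eq ?_),
    fun m y u => (abs_bubble_le_exp hA (hY m y) (hV u) hδ₀).trans (le_of_eq ?_)⟩
  · rw [l1_sub_symm]
  · ring

/-- [folklore] **(D) FOR `Ndν`**: `∃ C′, δ′ > 0, |Ndν m y u| ≤ C′·e^{−δ′·|n•y − u|₁}` (`Spr G`, `S` bond-localised, (LH), the companion's socket `hTloc`). -/
theorem Ndν_decay (hGa : Spr (Ga n a)) (hδs : 0 < δs) (hS : ∀ κ u, BiLoc (S κ u) u u Cs δs) (hδH : 0 < δH)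
    (hH : ∀ (m : Fin 4) (y : Site 4), BiLoc (ffOf (Hd m y)) ((n : ℤ) • y) ((n : ℤ) • y) CH δH) (hδT : 0 < δT)
    (hTloc : ∀ m y κ u, BiLoc (Td m y κ u) ((n : ℤ) • y) ((n : ℤ) • y) (CT * Real.exp (-δT * l1 ((n : ℤ) • y - u))) δT) (μ : Fin 4) :
    ∃ C' δ' : ℝ, 0 < δ' ∧ ∀ (m : Fin 4) (y u : Site 4), |Ndν n a S Hd Td c₁ c₂ μ m y u| ≤ C' * Real.exp (-δ' * l1 ((n : ℤ) • y - u)) := by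
  obtain ⟨KB, δB, hKB, hδB, hB, -⟩ := exists_bubble_H_decay n hGa hδs hS hδH hH μ
  obtain ⟨KT, δT', hKT, hδT', hT⟩ := exists_tadpole_T_decay n hGa hδT hTloc μ
  obtain ⟨C', δ', hδ', h⟩ := decay_of_two n ((n : ℝ) ^ 8)⁻¹ (c₁ * (1 / 2 : ℝ)) (c₂ * (1 / 2 : ℝ)) hKB hKT hδB hδT'
    (fun m y u => hB m y u) (fun m y u => hT m y u)
  exact ⟨C', δ', hδ', fun m y u => Eq.trans_le (by simp only [Ndν]; congr 1; ring) (h m y u)⟩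

/-- [folklore] The literal's stencil `S + c₁ • SdL n Hd` is bond-localised (one rate, explicit existence). -/
theorem exists_biLoc_lit (hδs : 0 < δs) (hS : ∀ κ u, BiLoc (S κ u) u u Cs δs) (hδH : 0 < δH)
    (hH : ∀ (m : Fin 4) (y : Site 4), BiLoc (ffOf (Hd m y)) ((n : ℤ) • y) ((n : ℤ) • y) CH δH) (c₁ : ℝ) :
    ∃ Cl δl : ℝ, 0 < δl ∧ ∀ (κ : Fin 4) (u : Site 4), BiLoc (S κ u + c₁ • SdL n Hd κ u) u u Cl δl := by
  obtain ⟨Cd, δd, hδd, hSd⟩ := exists_biLoc_SdL n hδH hH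
  exact ⟨|Cs| + |c₁| * |Cd|, min δs δd, lt_min hδs hδd, fun κ u =>
    biLoc_add (biLoc_of_le (hS κ u) (min_le_left _ _)) (biLoc_smul (biLoc_of_le (hSd κ u) (min_le_right _ _)) c₁)⟩

/-- [folklore] **(D) FOR `Ndμ`**: `∃ C′, δ′ > 0, |Ndμ m y u| ≤ C′·e^{−δ′·|n•y − u|₁}`. -/
theorem Ndμ_decay (hGa : Spr (Ga n a)) (hδs : 0 < δs) (hS : ∀ κ u, BiLoc (S κ u) u u Cs δs) (hδH : 0 < δH)
    (hH : ∀ (m : Fin 4) (y : Site 4), BiLoc (ffOf (Hd m y)) ((n : ℤ) • y) ((n : ℤ) • y) CH δH) (hδT : 0 < δT)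
    (hTloc : ∀ m y κ u, BiLoc (Td m y κ u) ((n : ℤ) • y) ((n : ℤ) • y) (CT * Real.exp (-δT * l1 ((n : ℤ) • y - u))) δT) (ν : Fin 4) :
    ∃ C' δ' : ℝ, 0 < δ' ∧ ∀ (m : Fin 4) (y u : Site 4), |Ndμ n a S Hd Td c₁ c₂ ν m y u| ≤ C' * Real.exp (-δ' * l1 ((n : ℤ) • y - u)) := by
  obtain ⟨Cl, δl, hδl, hSl⟩ := exists_biLoc_lit n hδs hS hδH hH c₁
  obtain ⟨KB, δB, hKB, hδB, -, hB⟩ := exists_bubble_H_decay n hGa hδl (S := fun κ u => S κ u + c₁ • SdL n Hd κ u) hSl hδH hH ν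
  obtain ⟨KT, δT', hKT, hδT', hT⟩ := exists_tadpole_T_decay n hGa hδT hTloc ν
  obtain ⟨C', δ', hδ', h⟩ := decay_of_two n ((n : ℝ) ^ 8)⁻¹ (c₁ * (1 / 2 : ℝ)) (c₂ * (1 / 2 : ℝ)) hKB hKT hδB hδT'
    (fun m y u => hB m y u) (fun m y u => hT m y u)
  exact ⟨C', δ', hδ', fun m y u => Eq.trans_le (by simp only [Ndμ]; congr 1; ring) (h m y u)⟩

end Decay

/-! ## §3 (Z) The zero-momentum letters -/

section Zero

variable {a c₁ c₂}

/-- [folklore] The road-stencil bubble against the base table is summable over the fine site (table in the second slot). -/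
theorem summable_bubble_H (hGa : Spr (Ga n a)) (hδs : 0 < δs) (hS : ∀ κ u, BiLoc (S κ u) u u Cs δs) (hδH : 0 < δH)
    (hH : ∀ (m : Fin 4) (y : Site 4), BiLoc (ffOf (Hd m y)) ((n : ℤ) • y) ((n : ℤ) • y) CH δH) (κ m : Fin 4) :
    Summable fun u : Site 4 => bubble (Ga n a) (S κ u) (ffOf (Hd m 0)) := by
  obtain ⟨KB, δB, -, hδB, hB, -⟩ := exists_bubble_H_decay n hGa hδs hS hδH hH κ
  exact summable_of_decay_base n hδB fun u => hB m 0 u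

/-- [folklore] The same with the table in the first slot. -/
theorem summable_bubble_H' (hGa : Spr (Ga n a)) (hδs : 0 < δs) (hS : ∀ κ u, BiLoc (S κ u) u u Cs δs) (hδH : 0 < δH)
    (hH : ∀ (m : Fin 4) (y : Site 4), BiLoc (ffOf (Hd m y)) ((n : ℤ) • y) ((n : ℤ) • y) CH δH) (κ m : Fin 4) :
    Summable fun u : Site 4 => bubble (Ga n a) (ffOf (Hd m 0)) (S κ u) := by
  obtain ⟨KB, δB, -, hδB, -, hB⟩ := exists_bubble_H_decay n hGa hδs hS hδH hH κ
  exact summable_of_decay_base n hδB fun u => hB m 0 u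

/-- [folklore] **THE WARD TOTAL AT BLOCKING ONE, GENERIC TABLE** (`LamPartnerZero.ward_total` with `hessFF n ↦ Hd`, `SbfBal ↦ S`): with the road's
stencil `V := ε • S` as the vertex family on the FINE bonds (`N := 1`), the base table `Y := ffOf (Hd m 0)` as the insertion (site `Q := 0`) and the
scaled companion `Z := c • Td m 0` as its jet, the covariance letters (W1)∕(W2′)^Δ give `c · Σ'_u tadpole G (Td m 0 α u) = ε · Σ'_u bubble G (S α u) Y`. -/
theorem ward_total_gen (hGa : Spr (Ga n a)) (hδs : 0 < δs) (hS : ∀ κ u, BiLoc (S κ u) u u Cs δs) (hδH : 0 < δH)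
    (hH : ∀ (m : Fin 4) (y : Site 4), BiLoc (ffOf (Hd m y)) ((n : ℤ) • y) ((n : ℤ) • y) CH δH) (hδT : 0 < δT)
    (hTloc : ∀ m y κ u, BiLoc (Td m y κ u) ((n : ℤ) • y) ((n : ℤ) • y) (CT * Real.exp (-δT * l1 ((n : ℤ) • y - u))) δT)
    (ε c : ℝ) {X : Site 4 → MKer 4 (Fin 4)} {Cx δx : ℝ} (hδx : 0 < δx) (hX : ∀ u, BiLoc (X u) u u Cx δx)
    (hW1 : ∀ u, comp (comp (Ga n a) (divV (fun κ v => ε • S κ v) u)) (Ga n a) = comp (Ga n a) (X u) - comp (X u) (Ga n a))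
    (m : Fin 4)
    (hW2 : ∀ u, divV (fun κ v => c • Td m 0 κ v) u = comp (X u) (ffOf (Hd m 0)) - comp (ffOf (Hd m 0)) (X u))
    (α : Fin 4) :
    c * ∑' u : Site 4, tadpole (Ga n a) (Td m 0 α u) = ε * ∑' u : Site 4, bubble (Ga n a) (S α u) (ffOf (Hd m 0)) := by
  -- one common rate
  obtain ⟨CA, δA, hδA, hAd⟩ := id hGa
  set δ₀ : ℝ := min (min δA δs) (min (min δT δH) δx) with hδ₀def
  have hδ₀ : 0 < δ₀ := lt_min (lt_min hδA hδs) (lt_min (lt_min hδT hδH) hδx)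
  have h0A : δ₀ ≤ δA := (min_le_left _ _).trans (min_le_left _ _)
  have h0s : δ₀ ≤ δs := (min_le_left _ _).trans (min_le_right _ _)
  have h0T : δ₀ ≤ δT := (min_le_right _ _).trans ((min_le_left _ _).trans (min_le_left _ _))
  have h0H : δ₀ ≤ δH := (min_le_right _ _).trans ((min_le_left _ _).trans (min_le_right _ _))
  have h0x : δ₀ ≤ δx := (min_le_right _ _).trans (min_le_right _ _)
  have hA : Decays (Ga n a) (|CA|) δ₀ := decays_of_le hAd h0A
  have hV : VertexFamily (fun κ v => ε • S κ v) 1 (|ε| * |Cs|) δ₀ := by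
    intro κ v
    rw [Nat.cast_one, one_smul]
    exact biLoc_smul (biLoc_of_le (hS κ v) h0s) ε
  have hY : BiLoc (ffOf (Hd m 0)) (0 : Site 4) 0 (|CH|) δ₀ := by
    have h := biLoc_of_le (hH m 0) h0H
    rwa [smul_zero] at h
  have hZ : ∀ κ v, BiLoc ((fun κ v => c • Td m 0 κ v) κ v) (((1 : ℕ) : ℤ) • v) 0 (|c| * |CT|) δ₀ := by
    intro κ v
    rw [Nat.cast_one, one_smul]
    have h1 := hTloc m 0 κ v
    rw [smul_zero] at h1
    -- re-centre the companion from `(0, 0)` to `(v, 0)`: the amplitude's decay pays for it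
    have h2 := biLoc_recentre h1 hδT.le v 0
    rw [sub_self, show l1 (0 : Site 4) = 0 from by simp [l1], add_zero, zero_sub, LamFactor.l1_neg, mul_assoc,
      ← Real.exp_add, show -δT * l1 v + δT * l1 v = 0 by ring, Real.exp_zero, mul_one] at h2
    exact biLoc_smul (biLoc_of_le h2 h0T) c
  have hX' : ∀ v, BiLoc (X v) (((1 : ℕ) : ℤ) • v) (((1 : ℕ) : ℤ) • v) (|Cx|) δ₀ := by
    intro v
    rw [Nat.cast_one, one_smul]
    exact biLoc_of_le (hX v) h0x
  have R := tsum_resp_eq_zero (N := 1) (Q := 0) X le_rfl hA hV hZ hY hX' hδ₀ hW1 hW2 α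
  simp only [tadpole_smul, bubble_smul_left] at R
  -- split the total (both families are summable)
  have sT := (summable_tadpole_T n hGa hδT hTloc α m).mul_left ((1 / 2 : ℝ) * c)
  have sB := (summable_bubble_H n hGa hδs hS hδH hH α m).mul_left ((1 / 2 : ℝ) * ε)
  have e1 : ∀ u : Site 4, (1 / 2 : ℝ) * (c * tadpole (Ga n a) (Td m 0 α u)) - (1 / 2) * (ε * bubble (Ga n a) (S α u) (ffOf (Hd m 0))) =
      (1 / 2 : ℝ) * c * tadpole (Ga n a) (Td m 0 α u) - (1 / 2 : ℝ) * ε * bubble (Ga n a) (S α u) (ffOf (Hd m 0)) := fun u => by ring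
  simp only [e1] at R
  rw [sT.tsum_sub sB, tsum_mul_left, tsum_mul_left] at R
  linear_combination (2 : ℝ) * R

omit [NeZero n] in
/-- [folklore] `Loc` of a base table. -/
theorem loc_H (hδH : 0 < δH) (hH : ∀ (m : Fin 4) (y : Site 4), BiLoc (ffOf (Hd m y)) ((n : ℤ) • y) ((n : ℤ) • y) CH δH) (m : Fin 4) (y : Site 4) :
    Loc (ffOf (Hd m y)) :=
  ⟨(n : ℤ) • y, (n : ℤ) • y, CH, δH, hδH, hH m y⟩

/-- [folklore] **(Z-a)^Δ THE `T ⊗ T` CROSS TERM: THE GENERIC Λ-PACK AGAINST A BASE TABLE HAS ZERO TOTAL** — `Σ'_u bubble G (SdL n Hd κ u) (ffOf (Hd m 0)) = 0`: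
(L1) `bubble_SLam_left` (`= −Σ_{m′} Σ'_y Λ′_{m′,y}(κ,u)·bubble G (Y m′ y) (Y m 0)`), Fubini over `(y, u)` (the Y–Y bubble decays in `|n•y|₁` by `abs_bubble_le_exp`,
`Λ′` in `|n•y − u|₁`), and the monopole null `Σ'_u Λ′_{m′,y}(κ,u) = 0` (census identity (I) `tsum_affine_mul_lamCoeffOf` at the constant weight).  NO letter. -/
theorem tsum_bubble_SdL_eq_zero (hGa : Spr (Ga n a)) (hδH : 0 < δH)
    (hH : ∀ (m : Fin 4) (y : Site 4), BiLoc (ffOf (Hd m y)) ((n : ℤ) • y) ((n : ℤ) • y) CH δH) (κ m : Fin 4) :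
    ∑' u : Site 4, bubble (Ga n a) (SdL n Hd κ u) (ffOf (Hd m 0)) = 0 := by
  -- common rate for Λ′ and the tables, and the Λ-unfolding
  obtain ⟨CΛ, δΛ, hCΛ, hδΛ, -, hΛ, hHΛ⟩ := lam_table_common_rate n hδH hH
  have hunf : ∀ u : Site 4, bubble (Ga n a) (SdL n Hd κ u) (ffOf (Hd m 0)) =
      -∑ m' : Fin 4, ∑' y : Site 4, lamCoeffOf (KInv (N := n) (d := 3)) n m' y κ u *
        bubble (Ga n a) (ffOf (Hd m' y)) (ffOf (Hd m 0)) := fun u => bubble_SLam_left n hGa hCΛ hδΛ hΛ hHΛ (loc_H n hδH hH m 0) κ u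
  simp only [hunf]
  -- decay of the two factors
  obtain ⟨CA, δA, hδA, hAd⟩ := hGa
  set δ₀ : ℝ := min δA δH with hδ₀def
  have hδ₀ : 0 < δ₀ := lt_min hδA hδH
  have hA : Decays (Ga n a) (|CA|) δ₀ := decays_of_le hAd (min_le_left _ _)
  have hY : ∀ (m' : Fin 4) (y : Site 4), BiLoc (ffOf (Hd m' y)) ((n : ℤ) • y) ((n : ℤ) • y) (|CH|) δ₀ :=
    fun m' y => biLoc_of_le (hH m' y) (min_le_right _ _)
  set Kb : ℝ := (Fintype.card (Fin 4) : ℝ) * ((Fintype.card (Fin 4) : ℝ) * (((Fintype.card (Fin 4) : ℝ) * (|CA| * |CH|) * Zl 4 (δ₀ - δ₀ / 2)) *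
      ((Fintype.card (Fin 4) : ℝ) * (|CA| * |CH|) * Zl 4 (δ₀ - δ₀ / 2))) * Zl 4 (δ₀ / 2 / 2)) * Zl 4 (δ₀ / 2 / 2) with hKb
  have hb : ∀ (m' : Fin 4) (y : Site 4), |bubble (Ga n a) (ffOf (Hd m' y)) (ffOf (Hd m 0))| ≤
      Kb * Real.exp (-(δ₀ / 2 / 2) * l1 ((n : ℤ) • y - 0)) := by
    intro m' y
    have h := abs_bubble_le_exp (hA) (hY m' y) (hY m 0) hδ₀
    rwa [smul_zero] at h
  have hKb0 : 0 ≤ Kb := by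
    have h1 := Zl_nonneg (D := 4) (show 0 < δ₀ - δ₀ / 2 by linarith)
    have h2 := Zl_nonneg (D := 4) (show 0 < δ₀ / 2 / 2 by positivity)
    positivity
  -- joint summability of the `(y, u)` family, for each `m'`
  have hS : ∀ m' : Fin 4, Summable (Function.uncurry fun (y : Site 4) (u : Site 4) =>
      lamCoeffOf (KInv (N := n) (d := 3)) n m' y κ u * bubble (Ga n a) (ffOf (Hd m' y)) (ffOf (Hd m 0))) := by
    intro m'
    have hf : Summable fun y : Site 4 => Kb * Real.exp (-(δ₀ / 2 / 2) * l1 ((n : ℤ) • y - 0)) :=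
      (summable_exp_zsmul n (by positivity) 0).mul_left Kb
    have hg : Summable fun z : Site 4 => CΛ * Real.exp (-δΛ * l1 z) := by
      simpa only [sub_zero] using (ExpKernelCalculus.summable_exp_shift' (D := 4) hδΛ 0).mul_left CΛ
    have hmaj := hf.mul_of_nonneg hg (fun y => mul_nonneg hKb0 (Real.exp_pos _).le) (fun z => mul_nonneg hCΛ (Real.exp_pos _).le)
    set e : Site 4 × Site 4 ≃ Site 4 × Site 4 := Equiv.prodShear (Equiv.refl _) (fun y => Equiv.addRight ((n : ℤ) • y)) with he
    refine (e.summable_iff).mp (Summable.of_norm_bounded hmaj fun q => ?_)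
    rcases q with ⟨y, z⟩
    rw [Real.norm_eq_abs]
    have h1 := hΛ m' y κ (z + (n : ℤ) • y)
    rw [show (n : ℤ) • y - (z + (n : ℤ) • y) = -z by abel, LamFactor.l1_neg] at h1
    have h2 := hb m' y
    have e1 : ((Function.uncurry fun (y : Site 4) (u : Site 4) =>
        lamCoeffOf (KInv (N := n) (d := 3)) n m' y κ u * bubble (Ga n a) (ffOf (Hd m' y)) (ffOf (Hd m 0))) ∘ e) (y, z) =
        lamCoeffOf (KInv (N := n) (d := 3)) n m' y κ (z + (n : ℤ) • y) * bubble (Ga n a) (ffOf (Hd m' y)) (ffOf (Hd m 0)) := by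
      simp [he, Equiv.prodShear, Function.uncurry]
    rw [e1, abs_mul]
    show _ ≤ Kb * Real.exp (-(δ₀ / 2 / 2) * l1 ((n : ℤ) • y - 0)) * (CΛ * Real.exp (-δΛ * l1 z))
    calc |lamCoeffOf (KInv (N := n) (d := 3)) n m' y κ (z + (n : ℤ) • y)| * |bubble (Ga n a) (ffOf (Hd m' y)) (ffOf (Hd m 0))|
        ≤ (CΛ * Real.exp (-δΛ * l1 z)) * (Kb * Real.exp (-(δ₀ / 2 / 2) * l1 ((n : ℤ) • y - 0))) :=
          mul_le_mul h1 h2 (abs_nonneg _) (by positivity)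
      _ = Kb * Real.exp (-(δ₀ / 2 / 2) * l1 ((n : ℤ) • y - 0)) * (CΛ * Real.exp (-δΛ * l1 z)) := by ring
  -- Fubini and the monopole null
  obtain ⟨δ, C, hδ, hC, hKd⟩ := decays_KInv (N := n) (d := 3)
  have hnull : ∀ (m' : Fin 4) (y : Site 4), ∑' u : Site 4, lamCoeffOf (KInv (N := n) (d := 3)) n m' y κ u = 0 := by
    intro m' y
    have h := tsum_affine_mul_lamCoeffOf hKd hC hδ (fun _ => (0 : ℝ)) 1 n m' y κ
    simpa only [zero_mul, Finset.sum_const_zero, zero_add, one_mul] using h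
  have hin : ∀ m' : Fin 4, ∑' u : Site 4, ∑' y : Site 4, lamCoeffOf (KInv (N := n) (d := 3)) n m' y κ u *
      bubble (Ga n a) (ffOf (Hd m' y)) (ffOf (Hd m 0)) = 0 := by
    intro m'
    rw [(hS m').tsum_comm]
    refine (tsum_congr fun y => ?_).trans tsum_zero
    rw [tsum_mul_right, hnull m' y, zero_mul]
  have hsum : ∀ m' : Fin 4, Summable fun u : Site 4 => ∑' y : Site 4, lamCoeffOf (KInv (N := n) (d := 3)) n m' y κ u *
      bubble (Ga n a) (ffOf (Hd m' y)) (ffOf (Hd m 0)) := fun m' => (hS m').prod_symm.prod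
  rw [tsum_neg, Summable.tsum_finsetSum (fun m' _ => hsum m')]
  simp only [hin, Finset.sum_const_zero, neg_zero]

/-- [folklore] **THE ZERO-MOMENTUM LETTER OF `Ndν`** (FILE 4's `hZeroν`, BY NAME): under the road's covariance letter (W1) for `ε • S` (blocking one, fine
bonds), the Δ-letter (W2′)^Δ for `(−(ε·c₂∕c₁)) • Td m 0` against the base table `ffOf (Hd m 0)`, the generator's localisation `hX`, the companion's socket
`hTloc`, (LH), `c₁ ≠ 0` and `ε = ±1`:  `Σ'_{u′} Ndν m 0 u′ = 0` (no cross term on this side: the ν-partner's vertex is the road's `S`). -/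
theorem tsum_Ndν_eq_zero (hGa : Spr (Ga n a)) (hδs : 0 < δs) (hS : ∀ κ u, BiLoc (S κ u) u u Cs δs) (hδH : 0 < δH)
    (hH : ∀ (m : Fin 4) (y : Site 4), BiLoc (ffOf (Hd m y)) ((n : ℤ) • y) ((n : ℤ) • y) CH δH) (hδT : 0 < δT)
    (hTloc : ∀ m y κ u, BiLoc (Td m y κ u) ((n : ℤ) • y) ((n : ℤ) • y) (CT * Real.exp (-δT * l1 ((n : ℤ) • y - u))) δT)
    (hc₁ : c₁ ≠ 0) {ε : ℝ} (hε : ε = 1 ∨ ε = -1) {X : Site 4 → MKer 4 (Fin 4)} {Cx δx : ℝ} (hδx : 0 < δx) (hX : ∀ u, BiLoc (X u) u u Cx δx)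
    (hW1 : ∀ u, comp (comp (Ga n a) (divV (fun κ v => ε • S κ v) u)) (Ga n a) = comp (Ga n a) (X u) - comp (X u) (Ga n a))
    (m : Fin 4)
    (hW2 : ∀ u, divV (fun κ v => (-(ε * (c₂ / c₁))) • Td m 0 κ v) u = comp (X u) (ffOf (Hd m 0)) - comp (ffOf (Hd m 0)) (X u))
    (μ : Fin 4) :
    ∑' u' : Site 4, Ndν n a S Hd Td c₁ c₂ μ m 0 u' = 0 := by
  have hW := ward_total_gen n hGa hδs hS hδH hH hδT hTloc ε (-(ε * (c₂ / c₁))) hδx hX hW1 m hW2 μ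
  have hε2 : ε * ε = 1 := by rcases hε with h | h <;> rw [h] <;> norm_num
  set T : ℝ := ∑' u : Site 4, tadpole (Ga n a) (Td m 0 μ u) with hT
  set B : ℝ := ∑' u : Site 4, bubble (Ga n a) (S μ u) (ffOf (Hd m 0)) with hB
  -- from the Ward total: `c₁·B + c₂·T = 0`
  have key : c₁ * B + c₂ * T = 0 := by
    have h1 : ε * (-(ε * (c₂ / c₁)) * T) = ε * (ε * B) := by rw [hW]
    have h2 : c₂ / c₁ * T = -B := by nlinarith [h1, hε2]
    field_simp at h2
    linarith
  have e : ∀ u : Site 4, Ndν n a S Hd Td c₁ c₂ μ m 0 u =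
      (((n : ℝ) ^ 8)⁻¹ * c₁ * (1 / 2 : ℝ)) * bubble (Ga n a) (S μ u) (ffOf (Hd m 0))
        + (((n : ℝ) ^ 8)⁻¹ * c₂ * (1 / 2 : ℝ)) * tadpole (Ga n a) (Td m 0 μ u) := by
    intro u
    simp only [Ndν]
    ring
  have sB := summable_bubble_H n hGa hδs hS hδH hH μ m
  have sT := summable_tadpole_T n hGa hδT hTloc μ m
  rw [tsum_congr e, (sB.mul_left _).tsum_add (sT.mul_left _), tsum_mul_left, tsum_mul_left]
  linear_combination (((n : ℝ) ^ 8)⁻¹ * (1 / 2 : ℝ)) * key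

/-- [folklore] **THE ZERO-MOMENTUM LETTER OF `Ndμ`** (FILE 4's `hZeroμ`, BY NAME): the table sits in the first bubble slot (`bubble_comm`) against the
LITERAL's stencil `S + c₁ • SdL n Hd`; the `S`-part is the Ward total, the `c₁ • SdL`-part is the `T ⊗ T` cross term `tsum_bubble_SdL_eq_zero` (NO letter):
`Σ'_{u′} Ndμ m 0 u′ = 0` under the same letters as `tsum_Ndν_eq_zero`. -/
theorem tsum_Ndμ_eq_zero (hGa : Spr (Ga n a)) (hδs : 0 < δs) (hS : ∀ κ u, BiLoc (S κ u) u u Cs δs) (hδH : 0 < δH)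
    (hH : ∀ (m : Fin 4) (y : Site 4), BiLoc (ffOf (Hd m y)) ((n : ℤ) • y) ((n : ℤ) • y) CH δH) (hδT : 0 < δT)
    (hTloc : ∀ m y κ u, BiLoc (Td m y κ u) ((n : ℤ) • y) ((n : ℤ) • y) (CT * Real.exp (-δT * l1 ((n : ℤ) • y - u))) δT)
    (hc₁ : c₁ ≠ 0) {ε : ℝ} (hε : ε = 1 ∨ ε = -1) {X : Site 4 → MKer 4 (Fin 4)} {Cx δx : ℝ} (hδx : 0 < δx) (hX : ∀ u, BiLoc (X u) u u Cx δx)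
    (hW1 : ∀ u, comp (comp (Ga n a) (divV (fun κ v => ε • S κ v) u)) (Ga n a) = comp (Ga n a) (X u) - comp (X u) (Ga n a))
    (m : Fin 4)
    (hW2 : ∀ u, divV (fun κ v => (-(ε * (c₂ / c₁))) • Td m 0 κ v) u = comp (X u) (ffOf (Hd m 0)) - comp (ffOf (Hd m 0)) (X u))
    (ν : Fin 4) :
    ∑' u' : Site 4, Ndμ n a S Hd Td c₁ c₂ ν m 0 u' = 0 := by
  have hW := ward_total_gen n hGa hδs hS hδH hH hδT hTloc ε (-(ε * (c₂ / c₁))) hδx hX hW1 m hW2 ν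
  have hε2 : ε * ε = 1 := by rcases hε with h | h <;> rw [h] <;> norm_num
  obtain ⟨Cd, δd, hδd, hSd⟩ := exists_biLoc_SdL n hδH hH
  set T : ℝ := ∑' u : Site 4, tadpole (Ga n a) (Td m 0 ν u) with hT
  set B : ℝ := ∑' u : Site 4, bubble (Ga n a) (S ν u) (ffOf (Hd m 0)) with hB
  have key : c₁ * B + c₂ * T = 0 := by
    have h1 : ε * (-(ε * (c₂ / c₁)) * T) = ε * (ε * B) := by rw [hW]
    have h2 : c₂ / c₁ * T = -B := by nlinarith [h1, hε2]
    field_simp at h2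
    linarith
  -- the summand: Ward part (table moved to the second slot) + the `T ⊗ T` cross term
  have e : ∀ u : Site 4, Ndμ n a S Hd Td c₁ c₂ ν m 0 u =
      (((n : ℝ) ^ 8)⁻¹ * c₁ * (1 / 2 : ℝ)) * bubble (Ga n a) (S ν u) (ffOf (Hd m 0))
        + (((n : ℝ) ^ 8)⁻¹ * c₂ * (1 / 2 : ℝ)) * tadpole (Ga n a) (Td m 0 ν u)
        + (((n : ℝ) ^ 8)⁻¹ * c₁ * (1 / 2 : ℝ) * c₁) * bubble (Ga n a) (SdL n Hd ν u) (ffOf (Hd m 0)) := by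
    intro u
    have hLS : Loc (S ν u) := ⟨u, u, Cs, δs, hδs, hS ν u⟩
    have hLd : Loc (c₁ • SdL n Hd ν u) := Loc.smul c₁ ⟨u, u, Cd, δd, hδd, hSd ν u⟩
    have hLY : Loc (ffOf (Hd m 0)) := loc_H n hδH hH m 0
    simp only [Ndμ]
    rw [bubble_add_right hGa hLY hLS hLd, bubble_smul_right, bubble_comm hGa hLY hLS,
      bubble_comm hGa hLY ⟨u, u, Cd, δd, hδd, hSd ν u⟩]
    ring
  have sB := summable_bubble_H n hGa hδs hS hδH hH ν m
  have sT := summable_tadpole_T n hGa hδT hTloc ν m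
  have sL : Summable fun u : Site 4 => bubble (Ga n a) (SdL n Hd ν u) (ffOf (Hd m 0)) := summable_bubble_H n hGa hδd hSd hδH hH ν m
  rw [tsum_congr e, ((sB.mul_left _).add (sT.mul_left _)).tsum_add (sL.mul_left _), (sB.mul_left _).tsum_add (sT.mul_left _),
    tsum_mul_left, tsum_mul_left, tsum_mul_left, tsum_bubble_SdL_eq_zero n hGa hδH hH ν m]
  linear_combination (((n : ℝ) ^ 8)⁻¹ * (1 / 2 : ℝ)) * key

end Zero

end Summit.QuantumFields.BalabanUV.Beta.D1BFx.LamDiffPartnerLetters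

end
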